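import Summits.AtomisticToContinuum.FouriersLaw.Theorems.RobinCoercivity.Negative.SchurPositivity

/-!
# HonestZwanzig / PositiveMemory — line `Sketch`, stub C: bilinear cut expansion of the Schur pairing

Support file for item `stmt-AtomisticToContinuum-12694` (`PositiveMemory`, route `HonestZwanzig`,
sub-problem `FouriersLaw`), stub C of skeleton v5 of line `Sketch`: the bilinear expansion of the Schur
pairing over weighted bond currents. At fixed chain length `N` and fixed Laplace variable `s ≥ 0`, with the
route's gadgets (`Adm`, `corr`, `lap_s`, `e_x`) as abstract variables carrying their defining equations and
the fixed-`N` package `hFI` (= route item `FeshbachIdentities`), the Schur-complement pairing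
`schur_s(f,g) = lap_s(f,g) − Σ_{u,v} lap_s(f,e_u) (G⁻¹)_{uv} lap_s(e_v,g)` (ANY matrix `G`) of two weighted
sums of the bond currents `j_b = (pinnedChain ω₂ lam β γ).bondCurrent N b` expands as
`schur_s(Σ_b g_b j_b, Σ_{b'} g'_{b'} j_{b'}) = Σ_{b,b'} g_b g'_{b'} schur_s(j_b, j_{b'})`.

Proof: additivity is the landed `sum_sum_schur_eq_schur_sum` (`…RobinCoercivity.Negative.SchurPositivity`,
admissibility of `g_b • j_b` by `adm_const_mul` + `adm_bondCurrent`); the scalars are pulled out of both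
slots by `lap_const_mul_left/right` (`…HonestZwanzigNetworkReductionBilinear`), packaged here as
`schur_const_mul`.
-/

noncomputable section

open MeasureTheory Finset Real Set Filter Topology
open Literature.MathematicalPhysics.KineticTheory.HeatConduction
open Summit.AtomisticToContinuum.FouriersLaw.Theorems.HonestZwanzig.NetworkReduction
open Summit.AtomisticToContinuum.FouriersLaw.Theorems.RobinCoercivity.Negative

namespace Summit.AtomisticToContinuum.FouriersLaw.Theorems.HonestZwanzig.PositiveMemory

section Package

variable {ω₂ lam β γ : ℝ} {N : ℕ} {T : ℝ}
  {Adm : (PhaseSpace N → ℝ) → Prop}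
  {corr : (PhaseSpace N → ℝ) → (PhaseSpace N → ℝ) → ℝ → ℝ}
  {lap : ℝ → (PhaseSpace N → ℝ) → (PhaseSpace N → ℝ) → ℝ}
  {cov : (PhaseSpace N → ℝ) → (PhaseSpace N → ℝ) → ℝ}
  {e : Fin N → PhaseSpace N → ℝ}
  (hAdm : ∀ f, Adm f ↔ (Continuous f ∧ ∃ A : ℝ, ∀ z,
    |f z| ≤ A * Real.exp ((pinnedChain ω₂ lam β γ).hamiltonian N z / (8 * T))))
  (hcorr : ∀ f g t, corr f g t =
    (∫ z, f z * (∫ y, g y ∂((pinnedChain ω₂ lam β γ).transitionKernel N T T t.toNNReal z))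
      ∂(pinnedChain ω₂ lam β γ).gibbsMeasure N T) -
    (∫ z, f z ∂(pinnedChain ω₂ lam β γ).gibbsMeasure N T) *
      (∫ z, g z ∂(pinnedChain ω₂ lam β γ).gibbsMeasure N T))
  (hlap : ∀ s f g, lap s f g = ∫ t in Set.Ioi (0 : ℝ), Real.exp (-(s * t)) * corr f g t)
  (hcov : ∀ f g, cov f g = (∫ z, f z * g z ∂(pinnedChain ω₂ lam β γ).gibbsMeasure N T) -
    (∫ z, f z ∂(pinnedChain ω₂ lam β γ).gibbsMeasure N T) *
      (∫ z, g z ∂(pinnedChain ω₂ lam β γ).gibbsMeasure N T))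
  (he : ∀ x z, e x z = z.2 x ^ 2 / 2 + (pinnedChain ω₂ lam β γ).U (z.1 x) +
    ∑ j : Fin N, ((if j.val = x.val + 1 then (pinnedChain ω₂ lam β γ).V (z.1 j - z.1 x) / 2 else 0) +
      (if x.val = j.val + 1 then (pinnedChain ω₂ lam β γ).V (z.1 x - z.1 j) / 2 else 0)))
  (hFI : ∀ f g : PhaseSpace N → ℝ, Adm f → Adm g →
    Integrable f ((pinnedChain ω₂ lam β γ).gibbsMeasure N T) ∧
    (∀ t : ℝ, 0 ≤ t → Integrable (fun z => f z *
      (∫ y, g y ∂((pinnedChain ω₂ lam β γ).transitionKernel N T T t.toNNReal z)))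
      ((pinnedChain ω₂ lam β γ).gibbsMeasure N T)) ∧
    IntegrableOn (corr f g) (Set.Ioi 0) ∧
    (∀ t : ℝ, 0 ≤ t → corr f g t = corr (fun z => g (z.1, -z.2)) (fun z => f (z.1, -z.2)) t) ∧
    (∀ s : ℝ, 0 < s → ∀ x : Fin N,
      s * lap s (e x) g - cov (e x) g =
        lap s (fun z => (pinnedChain ω₂ lam β γ).generator N T T (e x) (z.1, -z.2)) g ∧
      s * lap s f (e x) - cov f (e x) = lap s f ((pinnedChain ω₂ lam β γ).generator N T T (e x))))
  (hω : 0 < ω₂) (hl : 0 ≤ lam) (hβ : 0 ≤ β) (hT : 0 < T)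

include hcorr hlap in
/-- **Homogeneity of the Schur pairing in both slots** (no admissibility needed): for any matrix `G` in
the definition of `schur_s`, `schur_s(c·f, c'·g) = c c' · schur_s(f, g)`, from the homogeneity
`lap_const_mul_left/right` of the Laplace-transformed correlation. -/
theorem schur_const_mul {s : ℝ} (G : Matrix (Fin N) (Fin N) ℝ)
    (schur : (PhaseSpace N → ℝ) → (PhaseSpace N → ℝ) → ℝ)
    (hschur : ∀ f g, schur f g = lap s f g - ∑ u, ∑ v, lap s f (e u) * G⁻¹ u v * lap s (e v) g)
    (c c' : ℝ) (f f' : PhaseSpace N → ℝ) :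
    schur (fun z => c * f z) (fun z => c' * f' z) = c * c' * schur f f' := by
  rw [hschur, hschur]
  simp only [lap_const_mul_left hcorr hlap, lap_const_mul_right hcorr hlap]
  have h1 : ∑ u, ∑ v, c * lap s f (e u) * G⁻¹ u v * (c' * lap s (e v) f') =
      c * c' * ∑ u, ∑ v, lap s f (e u) * G⁻¹ u v * lap s (e v) f' := by
    rw [Finset.mul_sum]
    refine Finset.sum_congr rfl fun u _ => ?_
    rw [Finset.mul_sum]
    exact Finset.sum_congr rfl fun v _ => by ring
  rw [h1]
  ring

include hAdm hcorr hlap he hFI hω hl hβ hT in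
/-- **Stub C — bilinear cut expansion** (fixed `N`, fixed `s ≥ 0`, the `FeshbachIdentities` package): the Schur
pairing of two weighted bond-current sums expands over the bond memory kernel,
`schur_s(Σ_b g_b j_b, Σ_{b'} g'_{b'} j_{b'}) = Σ_{b,b'} g_b g'_{b'} schur_s(j_b, j_{b'})` (any matrix `G` in the
definition of `schur_s`; bilinearity of `lap_s` on admissible observables). -/
theorem stub_cutExpansion {s : ℝ} (hs : 0 ≤ s) (G : Matrix (Fin N) (Fin N) ℝ)
    (schur : (PhaseSpace N → ℝ) → (PhaseSpace N → ℝ) → ℝ)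
    (hschur : ∀ f g, schur f g = lap s f g - ∑ u, ∑ v, lap s f (e u) * G⁻¹ u v * lap s (e v) g)
    (g g' : Fin N → ℝ) :
    schur (fun z => ∑ b, g b * (pinnedChain ω₂ lam β γ).bondCurrent N b z)
        (fun z => ∑ b, g' b * (pinnedChain ω₂ lam β γ).bondCurrent N b z) =
      ∑ b, ∑ b', g b * g' b' *
        schur ((pinnedChain ω₂ lam β γ).bondCurrent N b) ((pinnedChain ω₂ lam β γ).bondCurrent N b') := by
  -- admissibility of the bond currents and of their scalar multiples
  have hj : ∀ b : Fin N, Adm ((pinnedChain ω₂ lam β γ).bondCurrent N b) :=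
    fun b => adm_bondCurrent Adm hAdm hω hl hβ hT b
  -- additivity of the Schur pairing in both slots (landed `sum_sum_schur_eq_schur_sum`)
  have hadd : ∑ b, ∑ b', schur (fun z => g b * (pinnedChain ω₂ lam β γ).bondCurrent N b z)
        (fun z => g' b' * (pinnedChain ω₂ lam β γ).bondCurrent N b' z) =
      schur (fun z => ∑ b, g b * (pinnedChain ω₂ lam β γ).bondCurrent N b z)
        (fun z => ∑ b, g' b * (pinnedChain ω₂ lam β γ).bondCurrent N b z) :=
    sum_sum_schur_eq_schur_sum hAdm hcorr hlap he hFI hω hl hβ hT hs G schur hschur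
      Finset.univ Finset.univ
      (fun b z => g b * (pinnedChain ω₂ lam β γ).bondCurrent N b z)
      (fun b z => g' b * (pinnedChain ω₂ lam β γ).bondCurrent N b z)
      (fun b _ => adm_const_mul Adm hAdm (g b) (hj b))
      (fun b _ => adm_const_mul Adm hAdm (g' b) (hj b))
  rw [← hadd]
  -- homogeneity, term by term
  refine Finset.sum_congr rfl fun b _ => Finset.sum_congr rfl fun b' _ => ?_
  exact schur_const_mul hcorr hlap G schur hschur (g b) (g' b')
    ((pinnedChain ω₂ lam β γ).bondCurrent N b) ((pinnedChain ω₂ lam β γ).bondCurrent N b')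

end Package

end Summit.AtomisticToContinuum.FouriersLaw.Theorems.HonestZwanzig.PositiveMemory

end
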